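import Literature.NumberTheory.EllipticCurves.Sprung2012.HondaLevelTwoRelationsProofs
import HarnessLib

/-!
# Sprung 2012, Thm. 2.2 / Cor. 2.10 at level `2`, in COORDINATES: the dual generation clauses of `IsHondaSystem` as
# «injective» and «`p`-saturated» on the `p²` free `ℤ_p`-coordinates of a functional on `E(k_2)` — proofs only (part 2 of 2)

Topic `Literature/NumberTheory/EllipticCurves`, cluster `Sprung2012` (namespace = path). A THEOREMS file (no definition,
no named fact; net Literature debt `0`). Cell `bsd-ssimc`, width seat `cruxlead-stmt-BirchSwinnertonDyer-19875-w3` (gen 7),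
lane «(IND) discharge» (see part 1, `HondaLevelTwoRelationsProofs.lean`, for the setting and the relations (R-i)–(R-iii)).
F. E. I. Sprung, *Iwasawa theory for elliptic curves at supersingular primes: A pair of main conjectures*, J. Number Theory
**132** (2012) [Sprung2012], Thm. 2.2 (p. 1487: «as a `ℤ_p[G_n]`-module, `F_ss(𝔪_n)` is generated by `c_n` and `c_{n−1}`»)
and Cor. 2.10 (p. 1489), level `n = 2`, in the tree's functional model (`ColemanMaps.lean`: the dual-form generation clauses
of `IsHondaSystem` — «`z ↦ (P_{2,c_2}(z), P_{2,c_1}(z))` is injective with `p`-saturated image mod `ω_2`»).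

## The mathematics

With the `p²` FREE COORDINATES `(y_r = z(gʳc_1))_{r<p}`, `(x_{r,i} = z(g^{r+pi}c_2))_{r<p, i<p−1}` of a functional `z` on
`E(K_2·K_v)` (all `2p²` orbit values are determined by them through (R-i)–(R-iii), the Honda unit `u = a_p(a_p−2) − (p−1)`
being invertible in `ℤ_p`), the level-`2` generation clauses read:
* (inj) `eq_zero_of_coordinates_eq_zero`: vanishing free coordinates ⇒ all orbit values vanish ⇒ `P_{2,c_2}(z) = P_{2,c_1}(z)
  = 0` ⇒ `z = 0`;
* (sat) `exists_of_coordinates_eq_prime_mul`: if the free coordinates of `z` are `p·(y, x)`, complete `(y, x)` to full orbit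
  vectors `(X_j, Y_j)_{j<p²}` by the relations, so that `p·(∑ X_j(1+T)ʲ, ∑ Y_j(1+T)ʲ) = (P_{2,c_2}(z), P_{2,c_1}(z))`; the
  saturation clause yields `z'` with `(∑ X_j(1+T)ʲ, ∑ Y_j(1+T)ʲ) ≡ (P_{2,c_2}(z'), P_{2,c_1}(z')) (mod ω_2)`, and coefficient
  extraction mod `ω_2` (part 1) shows `(y, x)` are the free coordinates of `z'`.
Consumer: `Sprung2012/ColemanMapJointCokernelIndependenceProofs.lean` — with `Literature/Algebra/Module/PadicDualLatticeRank`
(rank count) and Silverman VII.6.3 these two clauses make the free-coordinate map on `Hom(E(k_2), ℤ_p)` BIJECTIVE onto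
`ℤ_p^{p²}`, whence the point-independence clause (IND) of the (SES-KP) cokernel. Nothing here needs `K = ℚ`, `p` odd or any
torsion hypothesis; nothing about Selmer groups or BSD is asserted.

## References
* [Sprung2012] F. E. I. Sprung, J. Number Theory 132 (2012) 1483–1506: Thm. 2.2, Cor. 2.10 (pp. 1487–1489); Def. 3.1
  (p. 1489); Lemmas 7.4–7.5 (p. 1500).
* [KuriharaPollack2007] M. Kurihara, R. Pollack, Prop. 1.2. [LeiSujatha2021] A. Lei, R. Sujatha, §3 (SES-KP).
* Tree: `Sprung2012/{ColemanMaps, HondaLevelTwoRelationsProofs}.lean`.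
-/

noncomputable section

open scoped Classical

open Polynomial Finset

universe u

namespace Literature.NumberTheory.EllipticCurves.Sprung2012

open Literature.NumberTheory.EllipticCurves Literature.NumberTheory.GaloisRepresentations ZpExtension
  Literature.NumberTheory.EllipticCurves.Kobayashi2003 Literature.NumberTheory.EllipticCurves.Sprung2017

/-! ## §4 The generation clauses at level `2` in the free coordinates -/

section Coordinates

variable {K : Type u} [Field K] {p : ℕ} [Fact p.Prime] {κ : ZpExtension K p}
variable {E : Type u} [Field E] [Algebra K E] {ι : AlgebraicClosure K →ₐ[K] AlgebraicClosure E}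
variable {W : WeierstrassCurve K} {A : AddSubgroup (localPoints W E)}

/-- **The last orbit value of each residue class from the free ones (R-ii solved)**: for a functional `z` on any
`A ⊇ E(K_2·K_v)`, `z(g^{r+p(p−1)}c_2) = a_p·z(gʳc_1) − (a_p−2)·z(c₋₁) − ∑_{i<p−1} z(g^{r+pi}c_2)`.
[cite: Sprung2012, Thm. 2.2 (1)–(2) (p. 1487)] -/
theorem evalOn_pow_smul_honda_two_last (hA : localLayerPointsOfEmb κ ι W 2 ≤ A) {ap : ℤ}
    {g : Field.absoluteGaloisGroup E} (hg : κ.IsTopGenerator (resGalOfEmb ι g))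
    {cneg : localPoints W E} {c : ℕ → localPoints W E} (hH : IsHondaSystem κ ι W ap g cneg c) (z : A →+ ℤ_[p])
    (r : ℕ) :
    evalOn W A z (g ^ (r + p * (p - 1)) • c 2) = (ap : ℤ_[p]) * evalOn W A z (g ^ r • c 1)
      - ((ap - 2 : ℤ) : ℤ_[p]) * evalOn W A z cneg - ∑ i ∈ range (p - 1), evalOn W A z (g ^ (r + p * i) • c 2) := by
  have hp : p.Prime := Fact.out
  have h := sum_evalOn_pow_smul_honda_two hA hg hH z r
  have hsplit := sum_range_succ (fun i => evalOn W A z (g ^ (r + p * i) • c 2)) (p - 1)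
  rw [Nat.sub_add_cancel hp.one_le] at hsplit
  rw [hsplit] at h
  linear_combination h

/-- **Vanishing free coordinates kill all orbit values**: if `z(gʳc_1) = 0` (`r < p`) and `z(g^{r+pi}c_2) = 0` (`r < p`,
`i < p − 1`) then `z(c₋₁) = 0` (by (R-iii), `u` a unit), every `z(gʲc_1) = 0` (by (R-i)) and every `z(gʲc_2) = 0`, `j < p²`
(the last member of each residue class by (R-ii)). [cite: Sprung2012, Thm. 2.2 (p. 1487), Cor. 2.10 (p. 1489)] -/
theorem evalOn_orbit_eq_zero_of_coordinates_eq_zero (hA : localLayerPointsOfEmb κ ι W 2 ≤ A) {ap : ℤ}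
    (hap : (p : ℤ) ∣ ap) {g : Field.absoluteGaloisGroup E} (hg : κ.IsTopGenerator (resGalOfEmb ι g))
    {cneg : localPoints W E} {c : ℕ → localPoints W E} (hH : IsHondaSystem κ ι W ap g cneg c) (z : A →+ ℤ_[p])
    (hy : ∀ r < p, evalOn W A z (g ^ r • c 1) = 0)
    (hx : ∀ r < p, ∀ i < p - 1, evalOn W A z (g ^ (r + p * i) • c 2) = 0) :
    evalOn W A z cneg = 0 ∧ (∀ j, evalOn W A z (g ^ j • c 1) = 0) ∧
      ∀ j < p ^ 2, evalOn W A z (g ^ j • c 2) = 0 := by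
  have hp : p.Prime := Fact.out
  have hy' : ∀ j, evalOn W A z (g ^ j • c 1) = 0 := fun j => by
    rw [evalOn_pow_smul_honda_one hg hH z j]
    exact hy _ (Nat.mod_lt _ hp.pos)
  have hneg : evalOn W A z cneg = 0 := by
    have h := hondaUnit_mul_evalOn_cneg hA hg hH z
    rw [sum_eq_zero (fun k _ => hy' k)] at h
    exact (isUnit_hondaUnit hap).mul_right_eq_zero.mp h
  refine ⟨hneg, hy', fun j hj => ?_⟩
  have hi : j / p < p := Nat.div_lt_of_lt_mul (by rwa [← pow_two])
  rcases (Nat.le_sub_one_of_lt hi).lt_or_eq with hlt | heq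
  · have h := hx (j % p) (Nat.mod_lt _ hp.pos) (j / p) hlt
    rwa [Nat.mod_add_div] at h
  · have h := sum_evalOn_pow_smul_honda_two hA hg hH z (j % p)
    rw [hy' (j % p), hneg, mul_zero, mul_zero, sub_zero] at h
    have hsplit := sum_range_succ (fun i => evalOn W A z (g ^ (j % p + p * i) • c 2)) (p - 1)
    rw [Nat.sub_add_cancel hp.one_le] at hsplit
    rw [hsplit, sum_eq_zero (fun i hi => hx (j % p) (Nat.mod_lt _ hp.pos) i (mem_range.mp hi)), zero_add,
      ← heq, Nat.mod_add_div] at h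
    exact h

/-- **The injectivity clause of Thm. 2.2 / Cor. 2.10 at level `2`, in coordinates: a functional on `E(K_2·K_v)` whose `p²`
free coordinates `z(gʳc_1)` (`r < p`), `z(g^{r+pi}c_2)` (`r < p`, `i < p−1`) vanish is `0`** (all orbit values vanish, so
`P_{2,c_2}(z) = P_{2,c_1}(z) = 0` and the dual generation clause applies). [cite: Sprung2012, Thm. 2.2 (p. 1487), Cor. 2.10 (p. 1489)] -/
theorem eq_zero_of_coordinates_eq_zero {ap : ℤ} (hap : (p : ℤ) ∣ ap) {g : Field.absoluteGaloisGroup E}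
    (hg : κ.IsTopGenerator (resGalOfEmb ι g)) {cneg : localPoints W E} {c : ℕ → localPoints W E}
    (hH : IsHondaSystem κ ι W ap g cneg c) (z : localLayerPointsOfEmb κ ι W 2 →+ ℤ_[p])
    (hy : ∀ r < p, evalOn W (localLayerPointsOfEmb κ ι W 2) z (g ^ r • c 1) = 0)
    (hx : ∀ r < p, ∀ i < p - 1, evalOn W (localLayerPointsOfEmb κ ι W 2) z (g ^ (r + p * i) • c 2) = 0) :
    z = 0 := by
  obtain ⟨-, hy', hx'⟩ := evalOn_orbit_eq_zero_of_coordinates_eq_zero le_rfl hap hg hH z hy hx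
  obtain ⟨-, -, -, -, -, -, -, hinj, -⟩ := hH
  refine hinj 2 (by norm_num) z ?_ ?_
  · rw [pairingSum_def, sum_eq_zero fun j hj => ?_]
    · exact dvd_zero _
    rw [hx' j (mem_range.mp hj), map_zero, zero_mul]
  · show toIwasawa p (cyclotomicOmega p 2) ∣ pairingSum W _ g 2 (c 1) z
    rw [pairingSum_def, sum_eq_zero fun j hj => ?_]
    · exact dvd_zero _
    rw [hy' j, map_zero, zero_mul]

/-- **The `p`-saturation clause of Thm. 2.2 / Cor. 2.10 at level `2`, in coordinates**: if the free coordinates of a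
functional `z` on `E(K_2·K_v)` are `p`-multiples, `z(gʳc_1) = p·y_r` (`r < p`) and `z(g^{r+pi}c_2) = p·x_{r,i}` (`r < p`,
`i < p−1`), then some functional `z'` on `E(K_2·K_v)` has free coordinates `(y, x)`. Proof: complete `(y, x)` to full orbit
vectors `(Y_j)_{j<p²}`, `(X_j)_{j<p²}` by the relations (R-i)–(R-iii) (dividing (R-iii) by the unit `u`), so that
`p·(X, Y)` are the orbit values of `z`, i.e. `p·(a, b) = (P_{2,c_2}(z), P_{2,c_1}(z))` for `a = ∑ X_j(1+T)ʲ`,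
`b = ∑ Y_j(1+T)ʲ`; the saturation clause gives `z'` with `(a, b) ≡ (P_{2,c_2}(z'), P_{2,c_1}(z')) (mod ω_2)`, and coefficient
extraction (`eq_zero_of_toIwasawa_cyclotomicOmega_dvd_sum`) reads off the orbit values of `z'`.
[cite: Sprung2012, Thm. 2.2 (p. 1487), Cor. 2.10 (p. 1489), Lemmas 7.4–7.5 (p. 1500)] -/
theorem exists_of_coordinates_eq_prime_mul {ap : ℤ} (hap : (p : ℤ) ∣ ap) {g : Field.absoluteGaloisGroup E}
    (hg : κ.IsTopGenerator (resGalOfEmb ι g)) {cneg : localPoints W E} {c : ℕ → localPoints W E}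
    (hH : IsHondaSystem κ ι W ap g cneg c) (y : ℕ → ℤ_[p]) (x : ℕ → ℕ → ℤ_[p])
    (z : localLayerPointsOfEmb κ ι W 2 →+ ℤ_[p])
    (hy : ∀ r < p, evalOn W (localLayerPointsOfEmb κ ι W 2) z (g ^ r • c 1) = p * y r)
    (hx : ∀ r < p, ∀ i < p - 1, evalOn W (localLayerPointsOfEmb κ ι W 2) z (g ^ (r + p * i) • c 2) = p * x r i) :
    ∃ z' : localLayerPointsOfEmb κ ι W 2 →+ ℤ_[p],
      (∀ r < p, evalOn W (localLayerPointsOfEmb κ ι W 2) z' (g ^ r • c 1) = y r) ∧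
      (∀ r < p, ∀ i < p - 1, evalOn W (localLayerPointsOfEmb κ ι W 2) z' (g ^ (r + p * i) • c 2) = x r i) := by
  have hp : p.Prime := Fact.out
  have hA : localLayerPointsOfEmb κ ι W 2 ≤ localLayerPointsOfEmb κ ι W 2 := le_rfl
  -- the Honda unit and `ℓ = z'(c₋₁)` to be
  have hu : IsUnit (((ap * (ap - 2) - ((p : ℤ) - 1) : ℤ) : ℤ_[p])) := isUnit_hondaUnit hap
  set t : ℤ_[p] := ((hu.unit⁻¹ : ℤ_[p]ˣ) : ℤ_[p]) with ht
  have hut : (((ap * (ap - 2) - ((p : ℤ) - 1) : ℤ) : ℤ_[p])) * t = 1 := hu.mul_val_inv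
  set ℓ : ℤ_[p] := t * ∑ r ∈ range p, y r with hℓ
  have hℓz : (p : ℤ_[p]) * ℓ = evalOn W (localLayerPointsOfEmb κ ι W 2) z cneg := by
    have h1 := hondaUnit_mul_evalOn_cneg hA hg hH z
    rw [sum_congr rfl fun k hk => hy k (mem_range.mp hk), ← mul_sum] at h1
    refine hu.mul_left_cancel ?_
    calc (((ap * (ap - 2) - ((p : ℤ) - 1) : ℤ) : ℤ_[p])) * ((p : ℤ_[p]) * ℓ)
        = (p : ℤ_[p]) * (((((ap * (ap - 2) - ((p : ℤ) - 1) : ℤ) : ℤ_[p])) * t) * ∑ r ∈ range p, y r) := by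
          rw [hℓ]; ring
      _ = _ := by rw [hut, one_mul, h1]
  -- the full orbit vectors
  set Y : ℕ → ℤ_[p] := fun j => y (j % p) with hYdef
  set X : ℕ → ℤ_[p] := fun j => if j / p < p - 1 then x (j % p) (j / p)
      else (ap : ℤ_[p]) * y (j % p) - ((ap - 2 : ℤ) : ℤ_[p]) * ℓ - ∑ i ∈ range (p - 1), x (j % p) i with hXdef
  have hY : ∀ j, (p : ℤ_[p]) * Y j = evalOn W (localLayerPointsOfEmb κ ι W 2) z (g ^ j • c 1) := fun j => by
    rw [hYdef, ← hy _ (Nat.mod_lt _ hp.pos), ← evalOn_pow_smul_honda_one hg hH z j]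
  have hX : ∀ j < p ^ 2, (p : ℤ_[p]) * X j = evalOn W (localLayerPointsOfEmb κ ι W 2) z (g ^ j • c 2) := by
    intro j hj
    have hi : j / p < p := Nat.div_lt_of_lt_mul (by rwa [← pow_two])
    by_cases hlt : j / p < p - 1
    · rw [hXdef]
      simp only [hlt, if_true]
      rw [← hx _ (Nat.mod_lt _ hp.pos) _ hlt, Nat.mod_add_div]
    · have heq : j / p = p - 1 := le_antisymm (Nat.le_sub_one_of_lt hi) (not_lt.mp hlt)
      rw [hXdef]
      simp only [hlt, if_false]
      have h := sum_evalOn_pow_smul_honda_two hA hg hH z (j % p)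
      have hsplit := sum_range_succ
        (fun i => evalOn W (localLayerPointsOfEmb κ ι W 2) z (g ^ (j % p + p * i) • c 2)) (p - 1)
      rw [Nat.sub_add_cancel hp.one_le] at hsplit
      rw [hsplit, sum_congr rfl fun i hi => hx (j % p) (Nat.mod_lt _ hp.pos) i (mem_range.mp hi)] at h
      have hj' : g ^ j • c 2 = g ^ (j % p + p * (p - 1)) • c 2 := by
        rw [← heq, Nat.mod_add_div]
      rw [hj', mul_sub, mul_sub, mul_sum, ← mul_assoc, mul_comm (p : ℤ_[p]) (ap : ℤ_[p]), mul_assoc,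
        ← hy _ (Nat.mod_lt _ hp.pos), ← mul_assoc, mul_comm (p : ℤ_[p]) ((ap - 2 : ℤ) : ℤ_[p]), mul_assoc, hℓz]
      linear_combination (-1 : ℤ_[p]) * h
  -- the pair `(a, b)` with `p·(a, b) = (P_{2,c_2}(z), P_{2,c_1}(z))`
  set a : IwasawaAlgebra p := ∑ j ∈ range (p ^ 2), PowerSeries.C (X j) * (1 + PowerSeries.X) ^ j with ha
  set b : IwasawaAlgebra p := ∑ j ∈ range (p ^ 2), PowerSeries.C (Y j) * (1 + PowerSeries.X) ^ j with hb
  have hza : PowerSeries.C (p : ℤ_[p]) * a - pairingSum W (localLayerPointsOfEmb κ ι W 2) g 2 (c 2) z = 0 := by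
    rw [ha, pairingSum_def, mul_sum, ← sum_sub_distrib]
    refine sum_eq_zero fun j hj => ?_
    rw [← mul_assoc, ← map_mul, hX j (mem_range.mp hj), sub_self]
  have hzb : PowerSeries.C (p : ℤ_[p]) * b - pairingSum W (localLayerPointsOfEmb κ ι W 2) g 2 (c 1) z = 0 := by
    rw [hb, pairingSum_def, mul_sum, ← sum_sub_distrib]
    refine sum_eq_zero fun j _ => ?_
    rw [← mul_assoc, ← map_mul, hY j, sub_self]
  obtain ⟨-, -, -, -, -, -, -, -, hsat⟩ := id hH
  obtain ⟨z', hz'a, hz'b⟩ := hsat 2 (by norm_num) a b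
    ⟨z, by rw [hza]; exact dvd_zero _, by
      show toIwasawa p (cyclotomicOmega p 2) ∣
        PowerSeries.C (p : ℤ_[p]) * b - pairingSum W (localLayerPointsOfEmb κ ι W 2) g 2 (c 1) z
      rw [hzb]; exact dvd_zero _⟩
  -- read off the orbit values of `z'`
  have hXz' : ∀ j < p ^ 2, X j = evalOn W (localLayerPointsOfEmb κ ι W 2) z' (g ^ j • c 2) := by
    intro j hj
    have e : a - pairingSum W (localLayerPointsOfEmb κ ι W 2) g 2 (c 2) z' = ∑ j ∈ range (p ^ 2),
        PowerSeries.C (X j - evalOn W (localLayerPointsOfEmb κ ι W 2) z' (g ^ j • c 2)) * (1 + PowerSeries.X) ^ j := by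
      rw [ha, pairingSum_def, ← sum_sub_distrib]
      refine sum_congr rfl fun j _ => ?_
      rw [map_sub, sub_mul]
    rw [e] at hz'a
    exact sub_eq_zero.mp (eq_zero_of_toIwasawa_cyclotomicOmega_dvd_sum _ hz'a hj)
  have hYz' : ∀ j < p ^ 2, Y j = evalOn W (localLayerPointsOfEmb κ ι W 2) z' (g ^ j • c 1) := by
    intro j hj
    have hz'b' : toIwasawa p (cyclotomicOmega p 2) ∣
        b - pairingSum W (localLayerPointsOfEmb κ ι W 2) g 2 (c 1) z' := hz'b
    have e : b - pairingSum W (localLayerPointsOfEmb κ ι W 2) g 2 (c 1) z' = ∑ j ∈ range (p ^ 2),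
        PowerSeries.C (Y j - evalOn W (localLayerPointsOfEmb κ ι W 2) z' (g ^ j • c 1)) * (1 + PowerSeries.X) ^ j := by
      rw [hb, pairingSum_def, ← sum_sub_distrib]
      refine sum_congr rfl fun j _ => ?_
      rw [map_sub, sub_mul]
    rw [e] at hz'b'
    exact sub_eq_zero.mp (eq_zero_of_toIwasawa_cyclotomicOmega_dvd_sum _ hz'b' hj)
  have hpp : p ≤ p ^ 2 := by rw [pow_two]; exact Nat.le_mul_self p
  refine ⟨z', fun r hr => ?_, fun r hr i hi => ?_⟩
  · have h := hYz' r (lt_of_lt_of_le hr hpp)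
    rw [hYdef] at h
    simp only [Nat.mod_eq_of_lt hr] at h
    exact h.symm
  · have hj : r + p * i < p ^ 2 := by
      have h1 : i + 1 ≤ p := by omega
      calc r + p * i < p + p * i := by omega
        _ = p * (i + 1) := by ring
        _ ≤ p * p := Nat.mul_le_mul_left p h1
        _ = p ^ 2 := (pow_two p).symm
    have h := hXz' (r + p * i) hj
    have hmod : (r + p * i) % p = r := by rw [Nat.add_mul_mod_self_left, Nat.mod_eq_of_lt hr]
    have hdiv : (r + p * i) / p = i := by rw [Nat.add_mul_div_left _ _ hp.pos, Nat.div_eq_of_lt hr, zero_add]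
    rw [hXdef] at h
    simp only [hmod, hdiv, hi, if_true] at h
    exact h.symm

end Coordinates

end Literature.NumberTheory.EllipticCurves.Sprung2012

end
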